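import Mathlib
import HarnessLib

/-!
# High-order derivatives through partial fractions (Davis–Rabinowitz 1984, Sect. 4.5)

Davis–Rabinowitz, *Methods of Numerical Integration* (2nd ed., 1984), Sect. 4.5 "Error estimates through differences",
(4.5.6)–(4.5.10): error expressions of the usual sort involve high-order derivatives `f^{(M)}(ξ)` of the integrand, and
"for certain classes of functions the following device is useful".  Let `z₀, …, z_p` be distinct (real or complex)
numbers and `w(z) = (z - z₀) ⋯ (z - z_p)` (4.5.6).  If `f` is a polynomial of degree `≤ p`, Lagrange's formula gives
`f(z) = Σᵢ f(zᵢ) w(z) / ((z - zᵢ) w'(zᵢ))` (4.5.7)–(4.5.8), hence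
`f(z)/w(z) = Σᵢ (f(zᵢ)/w'(zᵢ)) · 1/(z - zᵢ)` (4.5.9) and, finally,
`dⁿ/dzⁿ (f(z)/w(z)) = (-1)ⁿ n! Σᵢ (f(zᵢ)/w'(zᵢ)) · (z - zᵢ)^{-(n+1)}` (4.5.10).

Recorded over an arbitrary field (the algebra (4.5.8)–(4.5.9), on top of Mathlib's `Lagrange.nodal` /
`Lagrange.interpolate`, with `w'(zᵢ)` in place of Mathlib's nodal weight) and over a nontrivially normed field (the
`n`-th derivative (4.5.10), as an `iteratedDeriv` at every non-node, via Mathlib's `iter_deriv_inv_linear_sub` and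
`iteratedDeriv_fun_sum`), plus the resulting norm bound over `ℝ`/`ℂ` when every node is at distance `≥ dᵢ` from the
point.  The text's worked example (`1/(1 + x⁴)`, complex nodes `e^{(2k+1)πi/4}`) is not reproduced.  Related tree
material (not duplicated): `Literature.Analysis.Complex.iteratedDeriv_inv_sub_const` (the single-pole identity over
`ℂ`, pointwise), `Literature.Analysis.Calculus.DividedDerivatives` (divided derivatives `f^{(j)}/j!`),
`Literature.NumberTheory.Transcendental.BallRivoalSeries.lagrange_div` (the special case of (4.5.9) with the integer
nodes `-1, …, -(n+1)` over `ℚ`).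

Provenance: engines group, shared numerical engines serving client cells; rigour lives in the verifiers; every
published number belongs to a client cell's ledger, not to the engines group.  Textbook facts only (no client
numbers).
-/

namespace Literature.Analysis.Quadrature

open Finset Polynomial Lagrange
open scoped Nat Topology

section Algebra

variable {F : Type*} [Field F] {ι : Type*} [DecidableEq ι] {s : Finset ι} {v : ι → F}

/-- `w'(zᵢ) = ∏_{j ≠ i} (zᵢ - z_j)` for `w(z) = ∏ⱼ (z - z_j)` (the denominators of (4.5.7)).
[cite: DavisRabinowitz1984, Sect. 4.5 (4.5.7)] -/
theorem eval_derivative_nodal_node {i : ι} (hi : i ∈ s) :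
    (derivative (nodal s v)).eval (v i) = ∏ j ∈ s.erase i, (v i - v j) := by
  rw [eval_nodal_derivative_eval_node_eq hi, eval_nodal]

/-- **(4.5.8)**: a polynomial `f` of degree `≤ p` equals `Σᵢ f(zᵢ) · w(z) / ((z - zᵢ) w'(zᵢ))` for `p + 1` distinct
nodes `zᵢ` (Lagrange's interpolation formula in the form (4.5.7)). [cite: DavisRabinowitz1984, Sect. 4.5 (4.5.8)] -/
theorem eq_sum_eval_div_derivative_nodal_mul (hvs : Set.InjOn v s) {f : F[X]} (hf : f.degree < #s) :
    f = ∑ i ∈ s, C (f.eval (v i) / (derivative (nodal s v)).eval (v i)) * (nodal s v / (X - C (v i))) := by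
  conv_lhs => rw [eq_interpolate hvs hf, interpolate_eq_nodalWeight_mul_nodal_div_X_sub_C]
  refine sum_congr rfl fun i hi => ?_
  rw [nodalWeight_eq_eval_derivative_nodal hi, div_eq_mul_inv, map_mul]
  ring

/-- **(4.5.9)**: off the nodes, `f(z)/w(z) = Σᵢ (f(zᵢ)/w'(zᵢ)) · (z - zᵢ)⁻¹` for `deg f ≤ p`.
[cite: DavisRabinowitz1984, Sect. 4.5 (4.5.9)] -/
theorem eval_div_eval_nodal_eq_sum (hvs : Set.InjOn v s) {f : F[X]} (hf : f.degree < #s) {z : F}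
    (hz : ∀ i ∈ s, z ≠ v i) :
    f.eval z / (nodal s v).eval z = ∑ i ∈ s, f.eval (v i) / (derivative (nodal s v)).eval (v i) * (z - v i)⁻¹ := by
  have hw : (nodal s v).eval z ≠ 0 := eval_nodal_not_at_node hz
  have hf' : f.eval z = (nodal s v).eval z * ∑ i ∈ s, nodalWeight s v i * (z - v i)⁻¹ * f.eval (v i) := by
    conv_lhs => rw [eq_interpolate hvs hf]
    exact eval_interpolate_not_at_node _ hz
  rw [hf', mul_div_cancel_left₀ _ hw]
  refine sum_congr rfl fun i hi => ?_
  rw [nodalWeight_eq_eval_derivative_nodal hi]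
  ring

end Algebra

section Derivatives

variable {𝕜 : Type*} [NontriviallyNormedField 𝕜] {ι : Type*} [DecidableEq ι]

/-- `dⁿ/dzⁿ (z - a)⁻¹ = (-1)ⁿ n! (z - a)^{-1-n}` — (4.5.10) with a single node (`p = 0`, `f ≡ 1`), as an equality of
functions over any nontrivially normed field (at `z = a` both sides are the junk value `0`).  The tree's
`Literature.Analysis.Complex.iteratedDeriv_inv_sub_const` is the pointwise `ℂ`-valued form of the same identity; this
general-field function-level form is what `iteratedDeriv_sum_mul_inv_sub` below rewrites with.
[cite: DavisRabinowitz1984, Sect. 4.5 (4.5.10)] -/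
theorem iteratedDeriv_inv_sub (a : 𝕜) (n : ℕ) :
    iteratedDeriv n (fun z : 𝕜 => (z - a)⁻¹) = fun z => (-1) ^ n * n ! * (z - a) ^ (-1 - n : ℤ) := by
  have h := iter_deriv_inv_linear_sub n (1 : 𝕜) a
  simp only [one_mul, one_pow, mul_one] at h
  rw [iteratedDeriv_eq_iterate]
  exact h

omit [DecidableEq ι] in
/-- The `n`-th derivative of a partial-fraction sum `Σᵢ cᵢ (z - zᵢ)⁻¹` off the poles:
`(-1)ⁿ n! Σᵢ cᵢ (z - zᵢ)^{-1-n}`. [cite: DavisRabinowitz1984, Sect. 4.5 (4.5.10)] -/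
theorem iteratedDeriv_sum_mul_inv_sub (s : Finset ι) (c v : ι → 𝕜) {x : 𝕜} (hx : ∀ i ∈ s, x ≠ v i) (n : ℕ) :
    iteratedDeriv n (fun z => ∑ i ∈ s, c i * (z - v i)⁻¹) x
      = (-1) ^ n * n ! * ∑ i ∈ s, c i * (x - v i) ^ (-1 - n : ℤ) := by
  rw [iteratedDeriv_fun_sum (fun i hi => ?_)]
  · simp_rw [iteratedDeriv_const_mul_field, iteratedDeriv_inv_sub]
    rw [mul_sum]
    exact sum_congr rfl fun i _ => by ring
  · exact contDiffAt_const.mul ((contDiffAt_id.sub contDiffAt_const).inv (sub_ne_zero.2 (hx i hi)))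

/-- **(4.5.10)**: for `deg f ≤ p` and `p + 1` distinct nodes `zᵢ` with `w(z) = ∏ (z - zᵢ)`, at every non-node `x`,
`dⁿ/dzⁿ (f/w) (x) = (-1)ⁿ n! Σᵢ (f(zᵢ)/w'(zᵢ)) (x - zᵢ)^{-(n+1)}`. [cite: DavisRabinowitz1984, Sect. 4.5 (4.5.10)] -/
theorem iteratedDeriv_eval_div_nodal {s : Finset ι} {v : ι → 𝕜} (hvs : Set.InjOn v s) {f : 𝕜[X]}
    (hf : f.degree < #s) {x : 𝕜} (hx : ∀ i ∈ s, x ≠ v i) (n : ℕ) :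
    iteratedDeriv n (fun z => f.eval z / (nodal s v).eval z) x
      = (-1) ^ n * n ! *
          ∑ i ∈ s, f.eval (v i) / (derivative (nodal s v)).eval (v i) * (x - v i) ^ (-1 - n : ℤ) := by
  have hU : ∀ᶠ z in 𝓝 x, (nodal s v).eval z ≠ 0 :=
    (nodal s v).continuous.continuousAt.eventually_ne (eval_nodal_not_at_node hx)
  have heq : (fun z => f.eval z / (nodal s v).eval z) =ᶠ[𝓝 x]
      fun z => ∑ i ∈ s, f.eval (v i) / (derivative (nodal s v)).eval (v i) * (z - v i)⁻¹ := by
    filter_upwards [hU] with z hz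
    have hz' : ∀ i ∈ s, z ≠ v i := fun i hi h => hz (h ▸ eval_nodal_at_node hi)
    exact eval_div_eval_nodal_eq_sum hvs hf hz'
  rw [heq.iteratedDeriv_eq n, iteratedDeriv_sum_mul_inv_sub s _ v hx n]

end Derivatives

section Bound

variable {𝕜 : Type*} [RCLike 𝕜] {ι : Type*} [DecidableEq ι]

/-- The resulting **derivative bound** over `ℝ` or `ℂ`: if `|x - zᵢ| ≥ dᵢ > 0` for all `i`, then
`‖dⁿ/dzⁿ (f/w)(x)‖ ≤ n! Σᵢ ‖f(zᵢ)/w'(zᵢ)‖ dᵢ^{-(n+1)}` (the estimate used in the text's example).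
[cite: DavisRabinowitz1984, Sect. 4.5 (4.5.10)] -/
theorem norm_iteratedDeriv_eval_div_nodal_le {s : Finset ι} {v : ι → 𝕜} (hvs : Set.InjOn v s) {f : 𝕜[X]}
    (hf : f.degree < #s) {x : 𝕜} {d : ι → ℝ} (hd : ∀ i ∈ s, 0 < d i) (hxd : ∀ i ∈ s, d i ≤ ‖x - v i‖) (n : ℕ) :
    ‖iteratedDeriv n (fun z => f.eval z / (nodal s v).eval z) x‖
      ≤ n ! * ∑ i ∈ s, ‖f.eval (v i) / (derivative (nodal s v)).eval (v i)‖ * (d i)⁻¹ ^ (n + 1) := by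
  have hx : ∀ i ∈ s, x ≠ v i := fun i hi h => by
    have := hxd i hi; rw [h, sub_self, norm_zero] at this; exact absurd this (not_le.2 (hd i hi))
  rw [iteratedDeriv_eval_div_nodal hvs hf hx n, norm_mul, norm_mul, norm_pow, norm_neg, norm_one, one_pow, one_mul,
    RCLike.norm_natCast]
  gcongr
  refine (norm_sum_le _ _).trans (sum_le_sum fun i hi => ?_)
  rw [norm_mul, norm_zpow]
  gcongr
  rw [show (-1 - n : ℤ) = -((n + 1 : ℕ) : ℤ) by push_cast; ring, zpow_neg, zpow_natCast, ← inv_pow]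
  gcongr
  · exact hd i hi
  · exact hxd i hi

end Bound


end Literature.Analysis.Quadrature
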